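import Summits.Ventures.CertifiedManyBodySolver.Observables.PairLROTowerChargedBracket
import HarnessLib

/-!
# OP1-C, part 14: the grid theorem with the charge density bounded by AUXILIARY ONE-POINT NODES instead of a
# uniform operator-norm constant (the «tight form», reading (R2) of sr-mbsolver-menu-3)

HONEST FRAMING: first certified bounds on pairing observables; not a superconductivity verdict; a ceiling route,
never presence; nothing in this file is a number. Crew hubbard-obs (D-0042), seat hubbard-obs-p1
(`prover-hubbard-obs-p1-g9-0`, filed by `-g10-0`); lead RULINGS (ex2) d190 (custody p1), (fr) d210 («(ex2) GO», 2026-08-27). Zero compute; no definition; no named fact;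
no `sorry`.

`liminf_pairFieldLRO_le_sq_of_onePoint_chargedStationary_bound_TT'_near` moves the charged row from the grid chemical
potential `μ'` to the supporting slope `μ_c` (`|μ' − μ_c| ≤ Δ`) at the price `Δ·C_q`, `C_q` a UNIFORM bound on the
charge density `|Re⟨ζ,(N̂W_L − W_LN̂)ζ⟩|/L²` over all unit `ζ` (operator-norm type). A producer can instead certify,
on the same relaxation, two AUXILIARY one-point bounds on that density — one per sense — of the node shape
`c_± − A_± + Σ_σ m^±_σ(Re⟨ζ,N_σζ⟩/L² − ν) + k_±(u − Re⟨ζ,H_Lζ⟩/L²) ≤ ∓ Re⟨ζ,(N̂W_L − W_LN̂)ζ⟩/L²` (`k_± ≥ 0`, the SAME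
`ν`, `u` as the main node). Since `μ' − μ_c =: s` is a FIXED number in `[−Δ, Δ]`, the perturbation `s·density` is
absorbed into the main node's constant, filling multipliers and (nonnegative!) energy multiplier:
`c ↦ c + |s|(c_± − A_±)`, `μ_σ ↦ μ_σ + |s| m^±_σ`, `κ ↦ κ + |s| k_±` — and the base theorem
`liminf_pairFieldLRO_le_sq_of_onePoint_chargedStationary_bound_TT'` applies at `μ_c` with these data. Its ceiling is
the square of an affine function of `s`, hence (convexity) at most the larger of its values at `s = 0` and
`s = ±Δ`:

* **`liminf_pairFieldLRO_le_sq_of_onePoint_chargedStationary_bound_TT'_near_aux`** — conclusion `liminf_k u_k ≤ C` for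
  every `C` dominating the three squares `(c − A + (Σμ)(n/2 − ν))²`,
  `(c + Δ(c₊ − A₊) − A + (Σ_σ(μ_σ + Δ m⁺_σ))(n/2 − ν))²`, `(c + Δ(c₋ − A₋) − A + (Σ_σ(μ_σ + Δ m⁻_σ))(n/2 − ν))²`.
  With the canonical `ν = n/2` this is `(M + Δ·max(B₊, B₋))²`, `B_± = −(c_± − A_±)` the auxiliary CONSTANTS only —
  the energy and filling parts of the auxiliary nodes cost nothing.

References: T. Koma, H. Tasaki, J. Stat. Phys. 76 (1994) 745, Theorem 5 [KomaTasaki1994]; W. Pusz, S. L.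
Woronowicz, Comm. Math. Phys. 58 (1978) 273, §1 [PuszWoronowicz1978]; D. Ruelle, *Statistical Mechanics* (1969)
§3.4 [Ruelle1969].
-/

noncomputable section

namespace Summit.Ventures.CertifiedManyBodySolver.Observables

open Matrix Complex Finset Literature.MathematicalPhysics.QuantumLattice Literature.Probability.LatticeModels
open Literature.MathematicalPhysics.QuantumLattice.HubbardWave0 ThermodynamicLimit Filter Topology
open scoped ComplexOrder ComplexConjugate BigOperators

section NearAux

variable (g : Site 2 → ℝ)

/-- Convexity of the square along a segment: for `0 ≤ θ ≤ 1`, `((1−θ)a + θb)² ≤ C` once `a² ≤ C` and `b² ≤ C`.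
[folklore] -/
private theorem sq_convexComb_le {a b θ C : ℝ} (h0 : 0 ≤ θ) (h1 : θ ≤ 1) (ha : a ^ 2 ≤ C) (hb : b ^ 2 ≤ C) :
    ((1 - θ) * a + θ * b) ^ 2 ≤ C := by
  have hconv : ((1 - θ) * a + θ * b) ^ 2 ≤ (1 - θ) * a ^ 2 + θ * b ^ 2 := by
    nlinarith [mul_nonneg (mul_nonneg h0 (sub_nonneg.2 h1)) (sq_nonneg (a - b))]
  nlinarith [mul_le_mul_of_nonneg_left ha (sub_nonneg.2 h1), mul_le_mul_of_nonneg_left hb h0]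

/-- **OP1-C at a grid point with AUXILIARY charge-density nodes (the tight form).** Hypotheses of
`liminf_pairFieldLRO_le_sq_of_onePoint_chargedStationary_bound_TT'_near` except that the uniform bound `hWq` is
replaced by two one-point nodes `hauxp` / `hauxm` bounding `∓Re⟨ζ,(N̂W_L − W_LN̂)ζ⟩/L²` from below by
`c_± − A_± + Σ_σ m^±_σ(Re⟨ζ,N_σζ⟩/L² − ν) + k_±(u − Re⟨ζ,H_Lζ⟩/L²)` (`k_± ≥ 0`; same `ν`, `u`). Conclusion:
`liminf_k u_k ≤ C` whenever `C` dominates the squares at `s = 0`, `s = Δ` (sense `+`) and `s = −Δ` (sense `−`).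
[cite: KomaTasaki1994, Theorem 5] [cite: PuszWoronowicz1978, §1] [cite: Ruelle1969, §3.4] -/
theorem liminf_pairFieldLRO_le_sq_of_onePoint_chargedStationary_bound_TT'_near_aux (t t' : ℝ) {U n : ℝ}
    (hU : 0 ≤ U) (hn0 : 0 < n) (hn2 : n < 2) {c A κ u ν : ℝ} (μ : Fin 2 → ℝ) (hκ : 0 ≤ κ)
    (hu : energyDensityTT' t t' U n ≤ u) {μc μ' Δ : ℝ}
    (hμc : μc ∈ Set.Icc (chemPotMinusTT' t t' U n) (chemPotPlusTT' t t' U n)) (hnear : |μ' - μc| ≤ Δ)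
    {Λw : Finset (Site 2)} (wloc : FermionOp Λw)
    (hweven : wloc ∈ carEvenSubalgebra (Finset.univ : Finset (Orb (PolySite Λw))))
    (hwevenH : wlocᴴ ∈ carEvenSubalgebra (Finset.univ : Finset (Orb (PolySite Λw)))) (L₁ : ℕ)
    (hInjw : ∀ L : ℕ, L₁ ≤ L → Set.InjOn (Torus.proj (d := 2) L) ↑Λw)
    {DN : ℝ} (LN : ℕ) (hDN : 0 ≤ DN)
    (hDDN₁ : ∀ (L : ℕ) [NeZero L] (hL : L₁ ≤ L), LN ≤ L → ∀ χ : Fock (Orb (FermionTorus 2 L)), star χ ⬝ᵥ χ = 1 →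
      |(star χ ⬝ᵥ (((∑ v : TorusSite 2 L, relabel (Orb.translate v)
          (fermionEmbed (PolySite.toTorusEmb L (hInjw L hL)) (((1 / 2 : ℂ)) • (wloc + wlocᴴ)))) *
        ((∑ v : TorusSite 2 L, relabel (Orb.translate v)
          (fermionEmbed (PolySite.toTorusEmb L (hInjw L hL)) (((1 / 2 : ℂ)) • (wloc + wlocᴴ)))) * totalNumber -
          totalNumber * (∑ v : TorusSite 2 L, relabel (Orb.translate v)
          (fermionEmbed (PolySite.toTorusEmb L (hInjw L hL)) (((1 / 2 : ℂ)) • (wloc + wlocᴴ))))) -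
        ((∑ v : TorusSite 2 L, relabel (Orb.translate v)
          (fermionEmbed (PolySite.toTorusEmb L (hInjw L hL)) (((1 / 2 : ℂ)) • (wloc + wlocᴴ)))) * totalNumber -
          totalNumber * (∑ v : TorusSite 2 L, relabel (Orb.translate v)
          (fermionEmbed (PolySite.toTorusEmb L (hInjw L hL)) (((1 / 2 : ℂ)) • (wloc + wlocᴴ))))) *
        (∑ v : TorusSite 2 L, relabel (Orb.translate v)
          (fermionEmbed (PolySite.toTorusEmb L (hInjw L hL)) (((1 / 2 : ℂ)) • (wloc + wlocᴴ))))) *ᵥ χ)).re| ≤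
        DN * (L : ℝ) ^ 2)
    (hDDN₂ : ∀ (L : ℕ) [NeZero L] (hL : L₁ ≤ L), LN ≤ L → ∀ χ : Fock (Orb (FermionTorus 2 L)), star χ ⬝ᵥ χ = 1 →
      |(star χ ⬝ᵥ (((∑ v : TorusSite 2 L, relabel (Orb.translate v)
          (fermionEmbed (PolySite.toTorusEmb L (hInjw L hL)) ((I / 2 : ℂ) • (wlocᴴ - wloc)))) *
        ((∑ v : TorusSite 2 L, relabel (Orb.translate v)
          (fermionEmbed (PolySite.toTorusEmb L (hInjw L hL)) ((I / 2 : ℂ) • (wlocᴴ - wloc)))) * totalNumber -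
          totalNumber * (∑ v : TorusSite 2 L, relabel (Orb.translate v)
          (fermionEmbed (PolySite.toTorusEmb L (hInjw L hL)) ((I / 2 : ℂ) • (wlocᴴ - wloc))))) -
        ((∑ v : TorusSite 2 L, relabel (Orb.translate v)
          (fermionEmbed (PolySite.toTorusEmb L (hInjw L hL)) ((I / 2 : ℂ) • (wlocᴴ - wloc)))) * totalNumber -
          totalNumber * (∑ v : TorusSite 2 L, relabel (Orb.translate v)
          (fermionEmbed (PolySite.toTorusEmb L (hInjw L hL)) ((I / 2 : ℂ) • (wlocᴴ - wloc))))) *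
        (∑ v : TorusSite 2 L, relabel (Orb.translate v)
          (fermionEmbed (PolySite.toTorusEmb L (hInjw L hL)) ((I / 2 : ℂ) • (wlocᴴ - wloc))))) *ᵥ χ)).re| ≤
        DN * (L : ℝ) ^ 2)
    -- the two auxiliary one-point nodes on the charge density of `W_L` (same `ν`, `u`; energy multipliers ≥ 0)
    {cp Ap kp cm Am km : ℝ} (mp mm : Fin 2 → ℝ) (hkp : 0 ≤ kp) (hkm : 0 ≤ km)
    (hauxp : ∀ (L : ℕ) [NeZero L] (hL : L₁ ≤ L) (ζ : Fock (Orb (FermionTorus 2 L))), star ζ ⬝ᵥ ζ = 1 →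
      cp - Ap + ∑ σ : Fin 2, mp σ *
          ((star ζ ⬝ᵥ ((∑ y : FermionTorus 2 L, numberOp y σ) *ᵥ ζ)).re / (L : ℝ) ^ 2 - ν) +
        kp * (u - (star ζ ⬝ᵥ (hubbardTorusTT' L t t' U *ᵥ ζ)).re / (L : ℝ) ^ 2) ≤
        -((star ζ ⬝ᵥ ((totalNumber * (∑ v : TorusSite 2 L, relabel (Orb.translate v)
            (fermionEmbed (PolySite.toTorusEmb L (hInjw L hL)) wloc)) -
          (∑ v : TorusSite 2 L, relabel (Orb.translate v)
            (fermionEmbed (PolySite.toTorusEmb L (hInjw L hL)) wloc)) * totalNumber) *ᵥ ζ)).re / (L : ℝ) ^ 2))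
    (hauxm : ∀ (L : ℕ) [NeZero L] (hL : L₁ ≤ L) (ζ : Fock (Orb (FermionTorus 2 L))), star ζ ⬝ᵥ ζ = 1 →
      cm - Am + ∑ σ : Fin 2, mm σ *
          ((star ζ ⬝ᵥ ((∑ y : FermionTorus 2 L, numberOp y σ) *ᵥ ζ)).re / (L : ℝ) ^ 2 - ν) +
        km * (u - (star ζ ⬝ᵥ (hubbardTorusTT' L t t' U *ᵥ ζ)).re / (L : ℝ) ^ 2) ≤
        (star ζ ⬝ᵥ ((totalNumber * (∑ v : TorusSite 2 L, relabel (Orb.translate v)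
            (fermionEmbed (PolySite.toTorusEmb L (hInjw L hL)) wloc)) -
          (∑ v : TorusSite 2 L, relabel (Orb.translate v)
            (fermionEmbed (PolySite.toTorusEmb L (hInjw L hL)) wloc)) * totalNumber) *ᵥ ζ)).re / (L : ℝ) ^ 2)
    -- the node, with its charged row at the GRID chemical potential `μ'`
    (hboundC' : ∀ (L : ℕ) [NeZero L] (hL : L₁ ≤ L) (ζ : Fock (Orb (FermionTorus 2 L))), star ζ ⬝ᵥ ζ = 1 →
      c - A + ∑ σ : Fin 2, μ σ *
          ((star ζ ⬝ᵥ ((∑ y : FermionTorus 2 L, numberOp y σ) *ᵥ ζ)).re / (L : ℝ) ^ 2 - ν) +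
        κ * (u - (star ζ ⬝ᵥ (hubbardTorusTT' L t t' U *ᵥ ζ)).re / (L : ℝ) ^ 2) +
        (star ζ ⬝ᵥ (((hubbardTorusTT' L t t' U - (μ' : ℂ) • totalNumber) *
              (∑ v : TorusSite 2 L, relabel (Orb.translate v)
                (fermionEmbed (PolySite.toTorusEmb L (hInjw L hL)) wloc)) -
            (∑ v : TorusSite 2 L, relabel (Orb.translate v)
                (fermionEmbed (PolySite.toTorusEmb L (hInjw L hL)) wloc)) *
              (hubbardTorusTT' L t t' U - (μ' : ℂ) • totalNumber)) *ᵥ ζ)).re / (L : ℝ) ^ 2 ≤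
        -((expect (pairField g L) ζ).re / (L : ℝ) ^ 2))
    (ψ : ∀ L, Fock (Orb (FermionTorus 2 L)))
    (hψ : ∀ L, IsGroundStateInSector (hubbardTorusTT' L t t' U) (rectN n L) 0 (ψ L))
    (hψ1 : ∀ L, star (ψ L) ⬝ᵥ ψ L = 1) {C : ℝ}
    (hC0 : (c - A + (∑ σ : Fin 2, μ σ) * (n / 2 - ν)) ^ 2 ≤ C)
    (hCp : (c + Δ * (cp - Ap) - A + (∑ σ : Fin 2, (μ σ + Δ * mp σ)) * (n / 2 - ν)) ^ 2 ≤ C)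
    (hCm : (c + Δ * (cm - Am) - A + (∑ σ : Fin 2, (μ σ + Δ * mm σ)) * (n / 2 - ν)) ^ 2 ≤ C) :
    liminf (fun k : ℕ => (∑ x ∈ halfOpenBox 2 (2 * k), ∑ y ∈ halfOpenBox 2 (2 * k),
        torusPullback (pairFieldCorr g ψ) (2 * k) x y) / ((#(halfOpenBox 2 (2 * k)) : ℝ)) ^ 2) atTop ≤ C := by
  have hΔ : 0 ≤ Δ := (abs_nonneg _).trans hnear
  set s : ℝ := μ' - μc with hs
  -- the absorbed data, by the sign of `s`
  by_cases hsgn : 0 ≤ s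
  · -- sense `+`: use `hauxp` with weight `s`
    have hsΔ : s ≤ Δ := (le_abs_self _).trans hnear
    have hmain := liminf_pairFieldLRO_le_sq_of_onePoint_chargedStationary_bound_TT' g t t' hU hn0 hn2
      (c := c + s * (cp - Ap)) (A := A) (κ := κ + s * kp) (u := u) (ν := ν) (fun σ => μ σ + s * mp σ)
      (by positivity) hu hμc wloc hweven hwevenH L₁ hInjw LN hDN hDDN₁ hDDN₂ ?_ ψ hψ hψ1
    · -- convexity between `s = 0` and `s = Δ`
      refine hmain.trans ?_
      by_cases hΔ0 : Δ = 0
      · have hs0 : s = 0 := le_antisymm (hΔ0 ▸ hsΔ) hsgn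
        simp only [hs0, zero_mul, add_zero] at *
        exact hC0
      · have hΔpos : 0 < Δ := lt_of_le_of_ne hΔ (Ne.symm hΔ0)
        set θ : ℝ := s / Δ with hθ
        have hθ0 : 0 ≤ θ := div_nonneg hsgn hΔ
        have hθ1 : θ ≤ 1 := (div_le_one hΔpos).2 hsΔ
        have hsθ : s = θ * Δ := by rw [hθ, div_mul_cancel₀ _ hΔ0]
        have key : c + s * (cp - Ap) - A + (∑ σ : Fin 2, (μ σ + s * mp σ)) * (n / 2 - ν) =
            (1 - θ) * (c - A + (∑ σ : Fin 2, μ σ) * (n / 2 - ν)) +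
              θ * (c + Δ * (cp - Ap) - A + (∑ σ : Fin 2, (μ σ + Δ * mp σ)) * (n / 2 - ν)) := by
          simp only [Fin.sum_univ_two, hsθ]
          ring
        rw [key]
        exact sq_convexComb_le hθ0 hθ1 hC0 hCp
    · -- the node at `μc`
      intro L _ hL ζ hζ
      have hnode := hboundC' L hL ζ hζ
      have haux := hauxp L hL ζ hζ
      set H := hubbardTorusTT' L t t' U with hH
      set W := ∑ v : TorusSite 2 L, relabel (Orb.translate v)
        (fermionEmbed (PolySite.toTorusEmb L (hInjw L hL)) wloc) with hW
      set D : ℝ := (star ζ ⬝ᵥ ((totalNumber * W - W * totalNumber) *ᵥ ζ)).re / (L : ℝ) ^ 2 with hD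
      have e : (H - (μc : ℂ) • totalNumber) * W - W * (H - (μc : ℂ) • totalNumber) =
          ((H - (μ' : ℂ) • totalNumber) * W - W * (H - (μ' : ℂ) • totalNumber)) +
            (((μ' - μc : ℝ) : ℂ)) • (totalNumber * W - W * totalNumber) := by
        rw [Complex.ofReal_sub]
        exact commutator_sub_smul_totalNumber_shift H totalNumber W (μc : ℂ) (μ' : ℂ)
      have hrow : (star ζ ⬝ᵥ (((H - (μc : ℂ) • totalNumber) * W - W * (H - (μc : ℂ) • totalNumber)) *ᵥ ζ)).re /
          (L : ℝ) ^ 2 =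
          (star ζ ⬝ᵥ ((((H - (μ' : ℂ) • totalNumber) * W - W * (H - (μ' : ℂ) • totalNumber))) *ᵥ ζ)).re /
            (L : ℝ) ^ 2 + s * D := by
        rw [e, add_mulVec, smul_mulVec, dotProduct_add, dotProduct_smul, smul_eq_mul, Complex.add_re,
          Complex.re_ofReal_mul, add_div, hD, hs, mul_div_assoc]
      -- `s·D ≤ s·(−(cp − Ap) − Σ mp(dev) − kp(u − e))`
      have hsD : s * D ≤ s * (-(cp - Ap + ∑ σ : Fin 2, mp σ *
          ((star ζ ⬝ᵥ ((∑ y : FermionTorus 2 L, numberOp y σ) *ᵥ ζ)).re / (L : ℝ) ^ 2 - ν) +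
          kp * (u - (star ζ ⬝ᵥ (H *ᵥ ζ)).re / (L : ℝ) ^ 2))) :=
        mul_le_mul_of_nonneg_left (by linarith [haux]) hsgn
      rw [hrow]
      have expand : c + s * (cp - Ap) - A + ∑ σ : Fin 2, (μ σ + s * mp σ) *
            ((star ζ ⬝ᵥ ((∑ y : FermionTorus 2 L, numberOp y σ) *ᵥ ζ)).re / (L : ℝ) ^ 2 - ν) +
          (κ + s * kp) * (u - (star ζ ⬝ᵥ (H *ᵥ ζ)).re / (L : ℝ) ^ 2) =
          (c - A + ∑ σ : Fin 2, μ σ *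
            ((star ζ ⬝ᵥ ((∑ y : FermionTorus 2 L, numberOp y σ) *ᵥ ζ)).re / (L : ℝ) ^ 2 - ν) +
            κ * (u - (star ζ ⬝ᵥ (H *ᵥ ζ)).re / (L : ℝ) ^ 2)) +
          s * (cp - Ap + ∑ σ : Fin 2, mp σ *
            ((star ζ ⬝ᵥ ((∑ y : FermionTorus 2 L, numberOp y σ) *ᵥ ζ)).re / (L : ℝ) ^ 2 - ν) +
            kp * (u - (star ζ ⬝ᵥ (H *ᵥ ζ)).re / (L : ℝ) ^ 2)) := by
        simp only [Fin.sum_univ_two]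
        ring
      rw [expand]
      linarith [hnode, hsD]
  · -- sense `−`: use `hauxm` with weight `−s`
    have hsneg : s ≤ 0 := le_of_lt (not_le.1 hsgn)
    have hsΔ : -s ≤ Δ := (neg_le_abs _).trans hnear
    have hmain := liminf_pairFieldLRO_le_sq_of_onePoint_chargedStationary_bound_TT' g t t' hU hn0 hn2
      (c := c + (-s) * (cm - Am)) (A := A) (κ := κ + (-s) * km) (u := u) (ν := ν) (fun σ => μ σ + (-s) * mm σ)
      (by nlinarith) hu hμc wloc hweven hwevenH L₁ hInjw LN hDN hDDN₁ hDDN₂ ?_ ψ hψ hψ1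
    · refine hmain.trans ?_
      have hΔpos : 0 < Δ := lt_of_lt_of_le (by linarith [not_le.1 hsgn]) hsΔ
      set θ : ℝ := (-s) / Δ with hθ
      have hθ0 : 0 ≤ θ := div_nonneg (by linarith) hΔ
      have hθ1 : θ ≤ 1 := (div_le_one hΔpos).2 hsΔ
      have hsθ : -s = θ * Δ := by rw [hθ, div_mul_cancel₀ _ hΔpos.ne']
      have key : c + (-s) * (cm - Am) - A + (∑ σ : Fin 2, (μ σ + (-s) * mm σ)) * (n / 2 - ν) =
          (1 - θ) * (c - A + (∑ σ : Fin 2, μ σ) * (n / 2 - ν)) +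
            θ * (c + Δ * (cm - Am) - A + (∑ σ : Fin 2, (μ σ + Δ * mm σ)) * (n / 2 - ν)) := by
        simp only [Fin.sum_univ_two, hsθ]
        ring
      rw [key]
      exact sq_convexComb_le hθ0 hθ1 hC0 hCm
    · intro L _ hL ζ hζ
      have hnode := hboundC' L hL ζ hζ
      have haux := hauxm L hL ζ hζ
      set H := hubbardTorusTT' L t t' U with hH
      set W := ∑ v : TorusSite 2 L, relabel (Orb.translate v)
        (fermionEmbed (PolySite.toTorusEmb L (hInjw L hL)) wloc) with hW
      set D : ℝ := (star ζ ⬝ᵥ ((totalNumber * W - W * totalNumber) *ᵥ ζ)).re / (L : ℝ) ^ 2 with hD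
      have e : (H - (μc : ℂ) • totalNumber) * W - W * (H - (μc : ℂ) • totalNumber) =
          ((H - (μ' : ℂ) • totalNumber) * W - W * (H - (μ' : ℂ) • totalNumber)) +
            (((μ' - μc : ℝ) : ℂ)) • (totalNumber * W - W * totalNumber) := by
        rw [Complex.ofReal_sub]
        exact commutator_sub_smul_totalNumber_shift H totalNumber W (μc : ℂ) (μ' : ℂ)
      have hrow : (star ζ ⬝ᵥ (((H - (μc : ℂ) • totalNumber) * W - W * (H - (μc : ℂ) • totalNumber)) *ᵥ ζ)).re /
          (L : ℝ) ^ 2 =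
          (star ζ ⬝ᵥ ((((H - (μ' : ℂ) • totalNumber) * W - W * (H - (μ' : ℂ) • totalNumber))) *ᵥ ζ)).re /
            (L : ℝ) ^ 2 + s * D := by
        rw [e, add_mulVec, smul_mulVec, dotProduct_add, dotProduct_smul, smul_eq_mul, Complex.add_re,
          Complex.re_ofReal_mul, add_div, hD, hs, mul_div_assoc]
      -- `s·D = (−s)·(−D) ≤ (−s)·(−(cm − Am) − Σ mm(dev) − km(u − e))`
      have hsD : s * D ≤ (-s) * (-(cm - Am + ∑ σ : Fin 2, mm σ *
          ((star ζ ⬝ᵥ ((∑ y : FermionTorus 2 L, numberOp y σ) *ᵥ ζ)).re / (L : ℝ) ^ 2 - ν) +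
          km * (u - (star ζ ⬝ᵥ (H *ᵥ ζ)).re / (L : ℝ) ^ 2))) := by
        have h1 : (-s) * (-D) ≤ (-s) * (-(cm - Am + ∑ σ : Fin 2, mm σ *
            ((star ζ ⬝ᵥ ((∑ y : FermionTorus 2 L, numberOp y σ) *ᵥ ζ)).re / (L : ℝ) ^ 2 - ν) +
            km * (u - (star ζ ⬝ᵥ (H *ᵥ ζ)).re / (L : ℝ) ^ 2))) :=
          mul_le_mul_of_nonneg_left (by linarith [haux]) (by linarith)
        linarith
      rw [hrow]
      have expand : c + (-s) * (cm - Am) - A + ∑ σ : Fin 2, (μ σ + (-s) * mm σ) *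
            ((star ζ ⬝ᵥ ((∑ y : FermionTorus 2 L, numberOp y σ) *ᵥ ζ)).re / (L : ℝ) ^ 2 - ν) +
          (κ + (-s) * km) * (u - (star ζ ⬝ᵥ (H *ᵥ ζ)).re / (L : ℝ) ^ 2) =
          (c - A + ∑ σ : Fin 2, μ σ *
            ((star ζ ⬝ᵥ ((∑ y : FermionTorus 2 L, numberOp y σ) *ᵥ ζ)).re / (L : ℝ) ^ 2 - ν) +
            κ * (u - (star ζ ⬝ᵥ (H *ᵥ ζ)).re / (L : ℝ) ^ 2)) +
          (-s) * (cm - Am + ∑ σ : Fin 2, mm σ *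
            ((star ζ ⬝ᵥ ((∑ y : FermionTorus 2 L, numberOp y σ) *ᵥ ζ)).re / (L : ℝ) ^ 2 - ν) +
            km * (u - (star ζ ⬝ᵥ (H *ᵥ ζ)).re / (L : ℝ) ^ 2)) := by
        simp only [Fin.sum_univ_two]
        ring
      rw [expand]
      linarith [hnode, hsD]

end NearAux

end Summit.Ventures.CertifiedManyBodySolver.Observables

end
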